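/-
Copyright (c) 2026 the pub-hodgecm-mathlib formalisation cell (harness21).  Prover seat hodgecm-mathlib-A-p03 (g25); LEAD F0P3a-plan (g9) WORD T8-165 (ii)
«THE ϖ-MODULAR VERTEX FIXED-LATTICE COUNT» ((R2)-EP road, line «N6nsGerm»; EP-census pen B-p04 (g34)), 2026-09-01.
-/
import Literature.NumberTheory.Automorphic.SelfDualStableLatticeCountNormalized   -- ★ (L5-d3) `ncard_selfDualStable_smul_one_diag_eq_sum` (B-p10 (g24))
import Literature.NumberTheory.Automorphic.SelfDualLatticeCountFrameTransport      -- ★ (L5-d1) `ncard_selfDualStable_congr` (frame transport of the count)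
import Literature.NumberTheory.Automorphic.SelfDualLatticeCountFrameTransportCM    -- ★ (L5-d1) at `L_w`: `exists_ncard_selfDualStable_eq_smul_one`, `…_antidiagTwo_eq_zpow_smul_one`
import Literature.NumberTheory.Rogawski1990.UnitStableOrbitalIntegralHSideValue     -- ★ B-p10 `ncard_selfDualStable_zpow_smul_one_eq_sum_at` (the value at `w`)
import HarnessLib

/-!
# The ϖ-MODULAR `γ`-stable lattices of a hermitian plane: `M(H, γ) = S(ϖ⁻¹•H, γ)`, exponents count mod 2, and the normalised count
# `#M(ϖ^e·1, diag(a,c)) = Σ_{j ≤ N, j ≢ e (2)} w(j)` — the OTHER vertex colour of the fixed ball in the tree of `U(1,1)`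
(Kottwitz, *Tamagawa numbers* (1988) §2: orbital integrals of Euler–Poincaré functions as fixed-point counts on the building; Flicker (1998) §6 p. 95 REMARK;
Rogawski (1990) §4.9 Lemma 4.9.3, §12.6)

Topic `NumberTheory/Automorphic`; namespace `Literature.NumberTheory.Automorphic`.  THEOREMS ONLY (no definition, no instance, no notation, no named fact, no `sorry`);
kernel lane.  Cell `pub/hodgecm-mathlib`, F0∕P3a, line «N6nsGerm», road (R2)-EP «the rank-one Euler–Poincaré function of `U(Φ₂)_v`» — this file is the ϖ-MODULAR
VERTEX half of Kottwitz's count (the SELF-DUAL vertex half is ★ (L5-d3); the Iwahori EDGE count and the EP identity `V₀ + V₁ − E = 1` are the EP-assembler's).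
HONEST LABEL: HC_CM is proved only modulo the printed citations until rung 0 closes; nothing printed is asserted here — elementary lattice algebra.

THE SETS (socket token-exact, as in ★ (L5-d1)∕(L5-d3)).  `S(H, γ) = {Λ | (∃ g : GL₂(F), (∃ J′ ∈ glInt 2 F, ↑J′ = formCongr σ g H) ∧ Λ = span 𝒪 (range (↑g)ᵀ)) ∧ Λ.map γ = Λ}`
(the `γ`-stable lattices whose Gram matrix for `H` is UNIMODULAR = self-dual lattices), and the ϖ-MODULAR analogue
`M(H, γ) = {Λ | (∃ g, (∃ J′ ∈ glInt 2 F, ϖ • ↑J′ = formCongr σ g H) ∧ Λ = span 𝒪 (range (↑g)ᵀ)) ∧ Λ.map γ = Λ}` (Gram matrix `∈ ϖ · GL₂(𝒪)`, i.e. `Λ^∨ = ϖ⁻¹Λ` —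
the second vertex type of the Bruhat–Tits tree of the quasi-split `U(1,1)`).
* §1 **`exists_mem_glInt_smul_coe_eq_formCongr_iff`**, **`setOf_modularStable_eq_selfDualStable`** — `M(H, γ) = S(c⁻¹ • H, γ)` for any `c ≠ 0`: a lattice is
  `c`-modular for `H` iff it is self-dual for `c⁻¹H` (★ the form transport is linear in the form).  So EVERY ★ statement about `S` applies to `M` at the form `ϖ⁻¹H`.
* §2 **`ncard_selfDualStable_smul_mul_self_eq`** — exponents count MOD 2: `#S((c·c) • H, γ) = #S(H, γ)` for `σ`-fixed `c ≠ 0` (★ `ncard_selfDualStable_congr` at the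
  scalar frame `P = c•1`: `formCongr σ (c•1) H = (c·c)•H`, `P⁻¹γP = γ`).
* §3 **`ncard_modularStable_smul_one_diag_eq_sum`** — the normalised count in the eigenframe of a regular elliptic `γ = diag(a, c)` of type (1) (`|a| = |c| = 1`,
  `|a − c| = |ϖ^N|`), SAME hypotheses as ★ (L5-d3): `#M(ϖ^e • 1, γ) = Σ_{j ≤ N, j % 2 = 1 − e} w(j)`, `w(0) = 1`, `w(j) = q^{j−1}(q+1)` — the self-dual count is the
  `j ≡ e` half, the ϖ-modular count the `j ≢ e` half: together (**`ncard_selfDualStable_add_ncard_modularStable_eq_sum`**) ALL `Σ_{j ≤ N} w(j) = #B(centre, N)`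
  vertices of the fixed ball, independently of the class bit `e` (Kottwitz: `O_γ(f_EP) = χ(Fix γ)`; `((q+1)q^N − 2)∕(q − 1)` = ★ `phiH q N`).
* §4 AT THE CM PLACE `w` (`v` non-split, unramified; `σ_w`, `ϖ_w = ι_w(ϖ_v)`): **`exists_ncard_modularStable_eq_smul_one`** — for `J` hermitian with `det` of even order and
  `γ ∈ U(σ_w, J)` with an eigenframe, `#M(J, γ) = #S(ϖ_w^e • 1, diag u)` with the parity bit FLIPPED (`Even (log |⟨p₀,p₀⟩_J|) ↔ e = 1`) — ★ (L5-d1)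
  `exists_ncard_selfDualStable_eq_smul_one` applied to the form `ϖ_w⁻¹ • J`; **`exists_ncard_modularStable_antidiagTwo_eq_sum_at`** — the VALUE for `(Φ₂)_w`:
  `#M((Φ₂)_w, γ) = Σ_{j ≤ N, j % 2 = e} w(q_v, j)` (★ B-p10's normalised count at `w`); **`ncard_selfDualStable_add_ncard_modularStable_antidiagTwo_eq_sum_at`** —
  the class-free VERTEX TOTAL `#S + #M = Σ_{j ≤ N} w(q_v, j)` that Kottwitz's `O_γ(f_EP)` consumes.

## References
* [Kottwitz1988] R. E. Kottwitz, *Tamagawa numbers*, Ann. of Math. 127 (1988) 629–646: §2 (Euler–Poincaré functions; orbital integrals = Euler characteristics of fixed sets).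
* [Flicker1998UnitaryFL] Y. Z. Flicker, *Elementary proof of the fundamental lemma for a unitary group*, Canad. J. Math. 50 (1998): §4 Lemma I.I.1 p. 84, §6 p. 95 REMARK.
* [Rogawski1990] J. D. Rogawski, *Automorphic Representations of Unitary Groups in Three Variables* (1990): §4.9 Lemma 4.9.3 p. 61; §12.6 p. 174.
* [Jacobowitz1962] R. Jacobowitz, *Hermitian forms over local fields*, Amer. J. Math. 84 (1962): §7 (modular lattices).
-/

set_option autoImplicit false

noncomputable section

open scoped ValuativeRel Matrix MatrixGroups
open Matrix ValuativeRel Finset IsLocalRing NumberField IsDedekindDomain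

namespace Literature.NumberTheory.Automorphic

variable {F : Type*} [Field F] [ValuativeRel F] (σ : F →+* F)

/-! ## §1 `c`-modular for `H` = self-dual for `c⁻¹ • H` -/

omit [ValuativeRel F] in
/-- `ᵗσ(g)·(c•H)·g = c • ᵗσ(g)·H·g` (the form transport is linear in the form). [cite: Jacobowitz1962, §7] -/
theorem formCongr_smul_form (g : GL (Fin 2) F) (c : F) (H : Matrix (Fin 2) (Fin 2) F) : formCongr σ g (c • H) = c • formCongr σ g H := by
  simp only [formCongr, Matrix.mul_smul, Matrix.smul_mul]

/-- **The ϖ-modular token is the self-dual token of the rescaled form**: `(∃ J′ ∈ GL₂(𝒪), c • ↑J′ = ᵗσ(g) H g) ↔ (∃ J′ ∈ GL₂(𝒪), ↑J′ = ᵗσ(g) (c⁻¹H) g)` (`c ≠ 0`).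
[cite: Jacobowitz1962, §7] [cite: Kottwitz1988, §2] -/
theorem exists_mem_glInt_smul_coe_eq_formCongr_iff {c : F} (hc : c ≠ 0) (g : GL (Fin 2) F) (H : Matrix (Fin 2) (Fin 2) F) :
    (∃ J' ∈ glInt 2 F, c • (J' : Matrix (Fin 2) (Fin 2) F) = formCongr σ g H) ↔
      ∃ J' ∈ glInt 2 F, (J' : Matrix (Fin 2) (Fin 2) F) = formCongr σ g (c⁻¹ • H) := by
  rw [formCongr_smul_form]
  constructor
  · rintro ⟨J', hJ', h⟩
    exact ⟨J', hJ', by rw [← h, smul_smul, inv_mul_cancel₀ hc, one_smul]⟩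
  · rintro ⟨J', hJ', h⟩
    exact ⟨J', hJ', by rw [h, smul_smul, mul_inv_cancel₀ hc, one_smul]⟩

/-- **`M(H, γ) = S(c⁻¹ • H, γ)`** as sets of lattices: the `γ`-stable lattices whose `H`-Gram matrix lies in `c · GL₂(𝒪)` are exactly the `γ`-stable `c⁻¹H`-self-dual
lattices (`c = ϖ`: ϖ-modular for `H` = self-dual for `ϖ⁻¹H`). [cite: Jacobowitz1962, §7] [cite: Kottwitz1988, §2] -/
theorem setOf_modularStable_eq_selfDualStable {c : F} (hc : c ≠ 0) (H : Matrix (Fin 2) (Fin 2) F) (γ : GL (Fin 2) F) :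
    {Λ : Submodule 𝒪[F] (Fin 2 → F) |
        (∃ g : GL (Fin 2) F, (∃ J' ∈ glInt 2 F, c • (J' : Matrix (Fin 2) (Fin 2) F) = formCongr σ g H) ∧
          Λ = Submodule.span 𝒪[F] (Set.range ((g : Matrix (Fin 2) (Fin 2) F))ᵀ)) ∧
        Λ.map ((Matrix.toLin' (γ : Matrix (Fin 2) (Fin 2) F)).restrictScalars 𝒪[F]) = Λ} =
      {Λ : Submodule 𝒪[F] (Fin 2 → F) |
        (∃ g : GL (Fin 2) F, (∃ J' ∈ glInt 2 F, (J' : Matrix (Fin 2) (Fin 2) F) = formCongr σ g (c⁻¹ • H)) ∧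
          Λ = Submodule.span 𝒪[F] (Set.range ((g : Matrix (Fin 2) (Fin 2) F))ᵀ)) ∧
        Λ.map ((Matrix.toLin' (γ : Matrix (Fin 2) (Fin 2) F)).restrictScalars 𝒪[F]) = Λ} := by
  ext Λ
  simp only [Set.mem_setOf_eq, exists_mem_glInt_smul_coe_eq_formCongr_iff σ hc]

/-! ## §2 Exponents count mod 2: `#S((c·c) • H, γ) = #S(H, γ)` -/

omit [ValuativeRel F] in
/-- `ᵗσ(c•1) H (c•1) = (c·c) • H` for `σ`-fixed `c`. [cite: Jacobowitz1962, §7] -/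
theorem formCongr_eq_mul_self_smul_of_coe_eq_smul_one {c : F} (hσc : σ c = c) (P : GL (Fin 2) F)
    (hP : (P : Matrix (Fin 2) (Fin 2) F) = c • (1 : Matrix (Fin 2) (Fin 2) F)) (H : Matrix (Fin 2) (Fin 2) F) :
    formCongr σ P H = (c * c) • H := by
  have h1 : (c • (1 : Matrix (Fin 2) (Fin 2) F)).map σ = c • (1 : Matrix (Fin 2) (Fin 2) F) := by
    ext i j
    simp only [Matrix.map_apply, Matrix.smul_apply, Matrix.one_apply, smul_eq_mul, mul_ite, mul_one, mul_zero, apply_ite σ, hσc, map_zero]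
  rw [formCongr, hP, h1, Matrix.transpose_smul, Matrix.transpose_one, Matrix.smul_mul, Matrix.one_mul, Matrix.mul_smul, Matrix.mul_one, smul_smul]

omit [ValuativeRel F] in
/-- A scalar frame is central: `P⁻¹ γ P = γ` for `↑P = c • 1`. [cite: Kottwitz1988, §2] -/
theorem inv_mul_mul_eq_self_of_coe_eq_smul_one {c : F} (P : GL (Fin 2) F) (hP : (P : Matrix (Fin 2) (Fin 2) F) = c • (1 : Matrix (Fin 2) (Fin 2) F))
    (γ : GL (Fin 2) F) : P⁻¹ * γ * P = γ := by
  have hcomm : γ * P = P * γ := by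
    apply Units.ext
    rw [Units.val_mul, Units.val_mul, hP, Matrix.mul_smul, Matrix.mul_one, Matrix.smul_mul, Matrix.one_mul]
  rw [mul_assoc, hcomm, inv_mul_cancel_left]

/-- **EXPONENTS COUNT MOD 2**: `#S((c·c) • H, γ) = #S(H, γ)` for `σ`-fixed `c ≠ 0` — ★ `ncard_selfDualStable_congr` at the scalar frame `P = c•1` (the bijection
`Λ ↦ c⁻¹Λ`; `ᵗσ(P) H P = (c·c)•H`, `P⁻¹γP = γ`).  With `c = ϖ⁻¹` it identifies the counts for `ϖ^{e} • 1` and `ϖ^{e−2} • 1`. [cite: Kottwitz1988, §2]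
[cite: Flicker1998UnitaryFL, §6 p. 95 REMARK] -/
theorem ncard_selfDualStable_smul_mul_self_eq {c : F} (hc : c ≠ 0) (hσc : σ c = c) (H : Matrix (Fin 2) (Fin 2) F) (γ : GL (Fin 2) F) :
    {Λ : Submodule 𝒪[F] (Fin 2 → F) |
        (∃ g : GL (Fin 2) F, (∃ J' ∈ glInt 2 F, (J' : Matrix (Fin 2) (Fin 2) F) = formCongr σ g ((c * c) • H)) ∧
          Λ = Submodule.span 𝒪[F] (Set.range ((g : Matrix (Fin 2) (Fin 2) F))ᵀ)) ∧
        Λ.map ((Matrix.toLin' (γ : Matrix (Fin 2) (Fin 2) F)).restrictScalars 𝒪[F]) = Λ}.ncard =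
      {Λ : Submodule 𝒪[F] (Fin 2 → F) |
        (∃ g : GL (Fin 2) F, (∃ J' ∈ glInt 2 F, (J' : Matrix (Fin 2) (Fin 2) F) = formCongr σ g H) ∧
          Λ = Submodule.span 𝒪[F] (Set.range ((g : Matrix (Fin 2) (Fin 2) F))ᵀ)) ∧
        Λ.map ((Matrix.toLin' (γ : Matrix (Fin 2) (Fin 2) F)).restrictScalars 𝒪[F]) = Λ}.ncard := by
  set P : GL (Fin 2) F := ⟨c • (1 : Matrix (Fin 2) (Fin 2) F), c⁻¹ • (1 : Matrix (Fin 2) (Fin 2) F),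
    by rw [Matrix.smul_mul, Matrix.one_mul, smul_smul, mul_inv_cancel₀ hc, one_smul],
    by rw [Matrix.smul_mul, Matrix.one_mul, smul_smul, inv_mul_cancel₀ hc, one_smul]⟩ with hPdef
  have hP : (P : Matrix (Fin 2) (Fin 2) F) = c • (1 : Matrix (Fin 2) (Fin 2) F) := rfl
  have h := ncard_selfDualStable_congr σ H γ P
  rw [formCongr_eq_mul_self_smul_of_coe_eq_smul_one σ hσc P hP, inv_mul_mul_eq_self_of_coe_eq_smul_one P hP] at h
  exact h.symm

/-! ## §3 The normalised ϖ-modular count in the eigenframe of a regular elliptic element of type (1) -/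

section Count

variable {ϖ : F} (hϖ : IsUniformizingElement ϖ)
variable {σ}
variable (σO : 𝒪[F] →+* 𝒪[F]) (hσO' : ∀ x : 𝒪[F], ((σO x : 𝒪[F]) : F) = σ x) (hσσ : ∀ x, σO (σO x) = x)
variable (hσϖ : σ ϖ = ϖ) {e : ℕ} (he : e ≤ 1)
  {a c : F} {N : ℕ} (γ : GL (Fin 2) F) (hγ : (γ : Matrix (Fin 2) (Fin 2) F) = !![a, 0; 0, c])
  (ha : valuation F a = 1) (hc : valuation F c = 1) (hN : valuation F (a - c) = valuation F (ϖ ^ N))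

include hϖ hσO' hσσ hσϖ he hγ ha hc hN in
/-- **THE NORMALISED ϖ-MODULAR COUNT** (eigenframe of a type-(1) elliptic regular element): for `e ∈ {0, 1}`, `↑γ = diag(a, c)` with `|a| = |c| = 1`, `|a − c| = |ϖ^N|`,
over a complete discretely valued `F` whose residue field has `q²` elements and `σ` an involution of `𝒪` fixing `ϖ` and moving some element by a unit:
`#M(ϖ^e • 1, γ) = Σ_{j ≤ N, j % 2 = 1 − e} w(j)`, `w(0) = 1`, `w(j) = q^{j−1}(q+1)` — §1 (`M(ϖ^e•1) = S(ϖ^{e−1}•1)`), §2 (`ϖ^{−1}•1 ↦ ϖ^{1}•1`), ★ (L5-d3) at the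
other parity.  In the tree of `U(1,1)`: the ϖ-modular vertices of the fixed ball `B(centre, N)` are those at distance `j ≢ e (mod 2)` from the centre.
[cite: Kottwitz1988, §2] [cite: Flicker1998UnitaryFL, §6 p. 95 REMARK] [cite: Rogawski1990, §4.9 Lemma 4.9.3 p. 61] -/
theorem ncard_modularStable_smul_one_diag_eq_sum [IsDiscreteValuationRing 𝒪[F]] [Finite (ResidueField 𝒪[F])]
    [IsAdicComplete (maximalIdeal 𝒪[F]) 𝒪[F]] {a₀ : 𝒪[F]} (ha₀ : IsUnit (σO a₀ - a₀)) {q : ℕ} (hq : Nat.card (ResidueField 𝒪[F]) = q ^ 2) :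
    {Λ : Submodule 𝒪[F] (Fin 2 → F) |
        (∃ g : GL (Fin 2) F, (∃ J' ∈ glInt 2 F, ϖ • (J' : Matrix (Fin 2) (Fin 2) F) = formCongr σ g ((ϖ ^ (e : ℤ)) • (1 : Matrix (Fin 2) (Fin 2) F))) ∧
          Λ = Submodule.span 𝒪[F] (Set.range ((g : Matrix (Fin 2) (Fin 2) F))ᵀ)) ∧
        Λ.map ((Matrix.toLin' (γ : Matrix (Fin 2) (Fin 2) F)).restrictScalars 𝒪[F]) = Λ}.ncard =
      ∑ j ∈ (range (N + 1)).filter (fun j => j % 2 = 1 - e), (if j = 0 then 1 else q ^ (j - 1) * (q + 1)) := by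
  have hϖ0 : ϖ ≠ 0 := hϖ.ne_zero
  rw [setOf_modularStable_eq_selfDualStable σ hϖ0]
  rcases Nat.le_one_iff_eq_zero_or_eq_one.1 he with rfl | rfl
  · -- `e = 0`: `ϖ⁻¹ • (ϖ^0 • 1) = (ϖ⁻¹·ϖ⁻¹) • (ϖ^1 • 1)`, then §2 and ★ (L5-d3) at parity `1`
    have hform : ϖ⁻¹ • ((ϖ ^ ((0 : ℕ) : ℤ)) • (1 : Matrix (Fin 2) (Fin 2) F)) = (ϖ⁻¹ * ϖ⁻¹) • ((ϖ ^ ((1 : ℕ) : ℤ)) • (1 : Matrix (Fin 2) (Fin 2) F)) := by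
      rw [smul_smul, smul_smul, Nat.cast_zero, zpow_zero, mul_one, Nat.cast_one, zpow_one, mul_assoc, inv_mul_cancel₀ hϖ0, mul_one]
    rw [hform, ncard_selfDualStable_smul_mul_self_eq σ (inv_ne_zero hϖ0) (by rw [map_inv₀, hσϖ])]
    exact ncard_selfDualStable_smul_one_diag_eq_sum hϖ σO hσO' hσσ hσϖ le_rfl γ hγ ha hc hN ha₀ hq
  · -- `e = 1`: `ϖ⁻¹ • (ϖ^1 • 1) = ϖ^0 • 1`, ★ (L5-d3) at parity `0`
    have hform : ϖ⁻¹ • ((ϖ ^ ((1 : ℕ) : ℤ)) • (1 : Matrix (Fin 2) (Fin 2) F)) = (ϖ ^ ((0 : ℕ) : ℤ)) • (1 : Matrix (Fin 2) (Fin 2) F) := by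
      rw [smul_smul, Nat.cast_one, zpow_one, inv_mul_cancel₀ hϖ0, Nat.cast_zero, zpow_zero]
    rw [hform]
    exact ncard_selfDualStable_smul_one_diag_eq_sum hϖ σO hσO' hσσ hσϖ (Nat.zero_le 1) γ hγ ha hc hN ha₀ hq

include hϖ hσO' hσσ hσϖ he hγ ha hc hN in
/-- **KOTTWITZ'S VERTEX TOTAL**: `#S(ϖ^e • 1, γ) + #M(ϖ^e • 1, γ) = Σ_{j ≤ N} w(j)` — the self-dual (`j ≡ e`) and ϖ-modular (`j ≢ e`) halves together count ALL
vertices of the fixed ball `B(centre, N)` in the tree of `U(1,1)`, independently of the class bit `e`; the Iwahori EDGE count is this total minus one and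
`V₀ + V₁ − E = 1 = O_γ(f_EP)`. [cite: Kottwitz1988, §2] [cite: Rogawski1990, §12.6 p. 174] -/
theorem ncard_selfDualStable_add_ncard_modularStable_eq_sum [IsDiscreteValuationRing 𝒪[F]] [Finite (ResidueField 𝒪[F])]
    [IsAdicComplete (maximalIdeal 𝒪[F]) 𝒪[F]] {a₀ : 𝒪[F]} (ha₀ : IsUnit (σO a₀ - a₀)) {q : ℕ} (hq : Nat.card (ResidueField 𝒪[F]) = q ^ 2) :
    {Λ : Submodule 𝒪[F] (Fin 2 → F) |
        (∃ g : GL (Fin 2) F, (∃ J' ∈ glInt 2 F, (J' : Matrix (Fin 2) (Fin 2) F) = formCongr σ g ((ϖ ^ (e : ℤ)) • (1 : Matrix (Fin 2) (Fin 2) F))) ∧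
          Λ = Submodule.span 𝒪[F] (Set.range ((g : Matrix (Fin 2) (Fin 2) F))ᵀ)) ∧
        Λ.map ((Matrix.toLin' (γ : Matrix (Fin 2) (Fin 2) F)).restrictScalars 𝒪[F]) = Λ}.ncard +
      {Λ : Submodule 𝒪[F] (Fin 2 → F) |
        (∃ g : GL (Fin 2) F, (∃ J' ∈ glInt 2 F, ϖ • (J' : Matrix (Fin 2) (Fin 2) F) = formCongr σ g ((ϖ ^ (e : ℤ)) • (1 : Matrix (Fin 2) (Fin 2) F))) ∧
          Λ = Submodule.span 𝒪[F] (Set.range ((g : Matrix (Fin 2) (Fin 2) F))ᵀ)) ∧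
        Λ.map ((Matrix.toLin' (γ : Matrix (Fin 2) (Fin 2) F)).restrictScalars 𝒪[F]) = Λ}.ncard =
      ∑ j ∈ range (N + 1), (if j = 0 then 1 else q ^ (j - 1) * (q + 1)) := by
  rw [ncard_selfDualStable_smul_one_diag_eq_sum hϖ σO hσO' hσσ hσϖ he γ hγ ha hc hN ha₀ hq,
    ncard_modularStable_smul_one_diag_eq_sum hϖ σO hσO' hσσ hσϖ he γ hγ ha hc hN ha₀ hq,
    ← Finset.sum_filter_add_sum_filter_not (range (N + 1)) (fun j => j % 2 = e)]
  congr 1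
  refine Finset.sum_congr ?_ fun _ _ => rfl
  ext j
  simp only [Finset.mem_filter]
  constructor
  · rintro ⟨hj, h⟩; exact ⟨hj, by omega⟩
  · rintro ⟨hj, h⟩; exact ⟨hj, by omega⟩

end Count


/-! ## §4 At the CM place `w`: the ϖ-modular count for `U(σ_w, J)(L_w)`, the value for `(Φ₂)_w`, and the class-free vertex total -/

namespace UnitaryGroup

open Literature.NumberTheory.Rogawski1990 Literature.NumberTheory.GaloisRepresentations

section CM

variable (L : Type) [Field L] [NumberField L] [IsCMField L] (v : HeightOneSpectrum (𝓞 ↥(maximalRealSubfield L)))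
  (w : PlacesOver L v) (hw : IsCMField.complexConj L • w.1 = w.1)

set_option maxHeartbeats 400000 in
include hw in
/-- **THE ϖ-MODULAR COUNT TRANSPORTED at an unramified non-split place (rank 2)**: for `J ∈ M₂(L_w)` `σ_w`-hermitian, `det J ≠ 0` of even order, and `γ ∈ U(σ_w, J)`
with an eigenframe `γ P = P · diag(u)` (`u₀ ≠ u₁` of norm one), there is `e ∈ {0,1}` with `Even (log |⟨p₀, p₀⟩_J|) ↔ e = 1` (the parity bit of ★
`exists_ncard_selfDualStable_eq_smul_one` FLIPPED) and `#M(J, γ) = #S(ϖ_w^e • 1, diag u)` — §1 puts `M(J, γ) = S(ϖ_w⁻¹J, γ)` and ★ (L5-d1) transports the form `ϖ_w⁻¹J`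
(still hermitian, `det` of even order, same unitary group). [cite: Kottwitz1988, §2] [cite: Rogawski1990, §4.9 Lemma 4.9.3 p. 61] [cite: Jacobowitz1962, §7] -/
theorem exists_ncard_modularStable_eq_smul_one (hunr : Algebra.IsUnramifiedIn (𝓞 L) v.asIdeal)
    {J : Matrix (Fin 2) (Fin 2) (w.1.adicCompletion L)} (hJ : (J.map (galAdicCompletionMap (L := L) (IsCMField.complexConj L) hw))ᵀ = J)
    (hJ0 : J.det ≠ 0) (hJev : Even (WithZero.log (Valued.v J.det)))
    {γ P : GL (Fin 2) (w.1.adicCompletion L)} {u : Fin 2 → w.1.adicCompletion L}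
    (hγ : γ ∈ Literature.AlgebraicGeometry.ShimuraVarieties.unitaryGroup (galAdicCompletionMap (L := L) (IsCMField.complexConj L) hw) J)
    (hP : (γ : Matrix (Fin 2) (Fin 2) (w.1.adicCompletion L)) * P = P * diagonal u) (hu : Function.Injective u)
    (hu1 : ∀ i, galAdicCompletionMap (L := L) (IsCMField.complexConj L) hw (u i) * u i = 1) :
    ∃ e : ℕ, e ≤ 1 ∧
      (Even (WithZero.log (Valued.v (twistGram (galAdicCompletionMap (L := L) (IsCMField.complexConj L) hw) J P.val 0 0))) ↔ e = 1) ∧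
      {Λ : Submodule 𝒪[w.1.adicCompletion L] (Fin 2 → w.1.adicCompletion L) |
          (∃ g : GL (Fin 2) (w.1.adicCompletion L),
            (∃ J' ∈ glInt 2 (w.1.adicCompletion L),
              (toPlace v w (HeckeCharacter.uniformizer ↥(maximalRealSubfield L) v : v.adicCompletion ↥(maximalRealSubfield L))) •
                  (J' : Matrix (Fin 2) (Fin 2) (w.1.adicCompletion L)) =
                formCongr (galAdicCompletionMap (L := L) (IsCMField.complexConj L) hw) g J) ∧
            Λ = Submodule.span 𝒪[w.1.adicCompletion L] (Set.range ((g : Matrix (Fin 2) (Fin 2) (w.1.adicCompletion L)))ᵀ)) ∧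
          Λ.map ((Matrix.toLin' ((γ : GL (Fin 2) (w.1.adicCompletion L)) : Matrix (Fin 2) (Fin 2) (w.1.adicCompletion L))).restrictScalars
            𝒪[w.1.adicCompletion L]) = Λ}.ncard =
      {Λ : Submodule 𝒪[w.1.adicCompletion L] (Fin 2 → w.1.adicCompletion L) |
          (∃ g : GL (Fin 2) (w.1.adicCompletion L),
            (∃ J' ∈ glInt 2 (w.1.adicCompletion L), (J' : Matrix (Fin 2) (Fin 2) (w.1.adicCompletion L)) =
              formCongr (galAdicCompletionMap (L := L) (IsCMField.complexConj L) hw) g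
                (toPlace v w (HeckeCharacter.uniformizer ↥(maximalRealSubfield L) v : v.adicCompletion ↥(maximalRealSubfield L)) ^ e •
                  (1 : Matrix (Fin 2) (Fin 2) (w.1.adicCompletion L)))) ∧
            Λ = Submodule.span 𝒪[w.1.adicCompletion L] (Set.range ((g : Matrix (Fin 2) (Fin 2) (w.1.adicCompletion L)))ᵀ)) ∧
          Λ.map ((Matrix.toLin' (diagonal u)).restrictScalars 𝒪[w.1.adicCompletion L]) = Λ}.ncard := by
  set σw := galAdicCompletionMap (L := L) (IsCMField.complexConj L) hw with hσw
  set ϖw : w.1.adicCompletion L :=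
    toPlace v w (HeckeCharacter.uniformizer ↥(maximalRealSubfield L) v : v.adicCompletion ↥(maximalRealSubfield L)) with hϖw
  have hϖ0 : ϖw ≠ 0 := toPlace_uniformizer_ne_zero L v w hunr
  have hσϖ : σw ϖw = ϖw := galAdicCompletionMap_toPlace_self L v w hw _
  have hvϖinv : Valued.v ϖw⁻¹ = WithZero.exp (1 : ℤ) := by
    rw [map_inv₀, valued_toPlace_uniformizer L v w hunr, ← WithZero.exp_neg, neg_neg]
  -- §1: `M(J, γ) = S(ϖ⁻¹J, γ)`
  rw [setOf_modularStable_eq_selfDualStable σw hϖ0 J γ]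
  -- the rescaled form is hermitian, non-degenerate of even determinant order, with the same unitary group
  have hJ' : ((ϖw⁻¹ • J).map σw)ᵀ = ϖw⁻¹ • J := by
    conv_rhs => rw [← hJ]
    ext i j
    simp only [Matrix.transpose_apply, Matrix.map_apply, Matrix.smul_apply, smul_eq_mul, map_mul, map_inv₀, hσϖ]
  have hJ'0 : (ϖw⁻¹ • J).det ≠ 0 := by
    rw [Matrix.det_smul, Fintype.card_fin]
    exact mul_ne_zero (pow_ne_zero _ (inv_ne_zero hϖ0)) hJ0
  have hJ'ev : Even (WithZero.log (Valued.v (ϖw⁻¹ • J).det)) := by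
    rw [Matrix.det_smul, Fintype.card_fin, map_mul, map_pow,
      WithZero.log_mul (pow_ne_zero _ ((Valuation.ne_zero_iff _).2 (inv_ne_zero hϖ0))) ((Valuation.ne_zero_iff _).2 hJ0), WithZero.log_pow, hvϖinv,
      WithZero.log_exp]
    exact (even_two_mul (1 : ℤ)).add (by simpa using hJev)
  have hγ' : γ ∈ Literature.AlgebraicGeometry.ShimuraVarieties.unitaryGroup σw (ϖw⁻¹ • J) := by
    show ((γ : Matrix (Fin 2) (Fin 2) (w.1.adicCompletion L)).map σw)ᵀ * (ϖw⁻¹ • J) * γ = ϖw⁻¹ • J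
    have h : ((γ : Matrix (Fin 2) (Fin 2) (w.1.adicCompletion L)).map σw)ᵀ * J * γ = J := hγ
    rw [Matrix.mul_smul, Matrix.smul_mul, h]
  obtain ⟨e, he1, hpar, hcount⟩ := exists_ncard_selfDualStable_eq_smul_one L v w hw hunr hJ' hJ'0 hJ'ev hγ' hP hu hu1
  refine ⟨e, he1, ?_, hcount⟩
  -- the parity bit flips: `⟨p₀,p₀⟩_{ϖ⁻¹J} = ϖ⁻¹ ⟨p₀,p₀⟩_J`
  have htw : twistGram σw (ϖw⁻¹ • J) P.val 0 0 = ϖw⁻¹ * twistGram σw J P.val 0 0 := by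
    simp only [twistGram_def, Matrix.mul_smul, Matrix.smul_mul, Matrix.smul_apply, smul_eq_mul]
  have hx0 : twistGram σw J P.val 0 0 ≠ 0 := twistGram_eigenframe_apply_ne_zero σw J hJ0 hγ hP hu hu1 0
  rw [htw, map_mul, WithZero.log_mul ((Valuation.ne_zero_iff _).2 (inv_ne_zero hϖ0)) ((Valuation.ne_zero_iff _).2 hx0), hvϖinv, WithZero.log_exp,
    add_comm, Int.even_add_one] at hpar
  rcases Nat.le_one_iff_eq_zero_or_eq_one.1 he1 with rfl | rfl
  · simp only [iff_true] at hpar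
    exact ⟨fun h => (hpar h).elim, fun h => absurd h zero_ne_one⟩
  · simp only [one_ne_zero, iff_false, not_not] at hpar
    exact ⟨fun _ => rfl, fun _ => hpar⟩

omit [IsCMField L] in
/-- `diagonal u = !![u₀, 0; 0, u₁]` (matrix bookkeeping). [folklore] -/
private theorem diagonal_eq_fin_two' (u : Fin 2 → w.1.adicCompletion L) :
    (diagonal u : Matrix (Fin 2) (Fin 2) (w.1.adicCompletion L)) = !![u 0, 0; 0, u 1] := by
  ext i j
  fin_cases i <;> fin_cases j <;> simp

include hw in
/-- **THE ϖ-MODULAR VALUE FOR `(Φ₂)_w`** (type (1)): at a place `v` unramified and non-split in `L`, for `γ ∈ U(σ_w, (Φ₂)_w)(L_w)` with an eigenframe `γ P = P · diag(u)`,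
`u₀ ≠ u₁` of norm one, `|u₀ − u₁|_w = |ϖ^N|`: there is `e ∈ {0,1}` with `Even (log |⟨p₀,p₀⟩|) ↔ e = 1` and
`#M((Φ₂)_w, γ) = Σ_{j ≤ N, j % 2 = e} w(q_v, j)`, `w(0) = 1`, `w(j) = q_v^{j−1}(q_v + 1)`, `q_v = |𝓞_{L⁺}∕v|` — the number of `γ`-fixed ϖ-MODULAR vertices of the tree of
`U(Φ₂)_v` (★ B-p10 `ncard_selfDualStable_zpow_smul_one_eq_sum_at` at the flipped parity). [cite: Kottwitz1988, §2] [cite: Flicker1998UnitaryFL, §6 p. 95 REMARK]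
[cite: Rogawski1990, §4.9 Lemma 4.9.3 p. 61; §12.6 p. 174] -/
theorem exists_ncard_modularStable_antidiagTwo_eq_sum_at (hunr : Algebra.IsUnramifiedIn (𝓞 L) v.asIdeal)
    {γ P : GL (Fin 2) (w.1.adicCompletion L)} {u : Fin 2 → w.1.adicCompletion L}
    (hγ : γ ∈ Literature.AlgebraicGeometry.ShimuraVarieties.unitaryGroup (galAdicCompletionMap (L := L) (IsCMField.complexConj L) hw)
      (placeForm (Matrix.of fun i j : Fin 2 => if i.val + j.val + 1 = 2 then (1 : L) else 0) w.1))
    (hP : (γ : Matrix (Fin 2) (Fin 2) (w.1.adicCompletion L)) * P = P * diagonal u) (hu : Function.Injective u)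
    (hu1 : ∀ i, galAdicCompletionMap (L := L) (IsCMField.complexConj L) hw (u i) * u i = 1) {N : ℕ}
    (hN : valuation (w.1.adicCompletion L) (u 0 - u 1) =
      valuation (w.1.adicCompletion L) (toPlace v w (HeckeCharacter.uniformizer ↥(maximalRealSubfield L) v : v.adicCompletion ↥(maximalRealSubfield L)) ^ N)) :
    ∃ e : ℕ, e ≤ 1 ∧
      (Even (WithZero.log (Valued.v (twistGram (galAdicCompletionMap (L := L) (IsCMField.complexConj L) hw)
        (placeForm (Matrix.of fun i j : Fin 2 => if i.val + j.val + 1 = 2 then (1 : L) else 0) w.1) P.val 0 0))) ↔ e = 1) ∧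
      {Λ : Submodule 𝒪[w.1.adicCompletion L] (Fin 2 → w.1.adicCompletion L) |
          (∃ g : GL (Fin 2) (w.1.adicCompletion L),
            (∃ J' ∈ glInt 2 (w.1.adicCompletion L),
              (toPlace v w (HeckeCharacter.uniformizer ↥(maximalRealSubfield L) v : v.adicCompletion ↥(maximalRealSubfield L))) •
                  (J' : Matrix (Fin 2) (Fin 2) (w.1.adicCompletion L)) =
                formCongr (galAdicCompletionMap (L := L) (IsCMField.complexConj L) hw) g
                  (placeForm (Matrix.of fun i j : Fin 2 => if i.val + j.val + 1 = 2 then (1 : L) else 0) w.1)) ∧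
            Λ = Submodule.span 𝒪[w.1.adicCompletion L] (Set.range ((g : Matrix (Fin 2) (Fin 2) (w.1.adicCompletion L)))ᵀ)) ∧
          Λ.map ((Matrix.toLin' ((γ : GL (Fin 2) (w.1.adicCompletion L)) : Matrix (Fin 2) (Fin 2) (w.1.adicCompletion L))).restrictScalars
            𝒪[w.1.adicCompletion L]) = Λ}.ncard =
      ∑ j ∈ (range (N + 1)).filter (fun j => j % 2 = e),
        (if j = 0 then 1 else Nat.card (𝓞 ↥(maximalRealSubfield L) ⧸ v.asIdeal) ^ (j - 1) * (Nat.card (𝓞 ↥(maximalRealSubfield L) ⧸ v.asIdeal) + 1)) := by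
  obtain ⟨e, he1, hpar, hcount⟩ := exists_ncard_modularStable_eq_smul_one L v w hw hunr (placeForm_antidiagTwo_hermitian L v w hw)
    (det_placeForm_antidiagTwo_ne_zero_and_even L v w).1 (det_placeForm_antidiagTwo_ne_zero_and_even L v w).2 hγ hP hu hu1
  refine ⟨e, he1, hpar, ?_⟩
  -- a `GL₂` representative of `diag(u)`: `γ′ := P⁻¹ γ P`
  have hγ' : (((P⁻¹ * γ * P : GL (Fin 2) (w.1.adicCompletion L))) : Matrix (Fin 2) (Fin 2) (w.1.adicCompletion L)) = !![u 0, 0; 0, u 1] := by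
    rw [Units.val_mul, Units.val_mul, Matrix.mul_assoc, hP, ← Matrix.mul_assoc, ← Units.val_mul, inv_mul_cancel, Units.val_one, Matrix.one_mul,
      diagonal_eq_fin_two']
  rw [hcount, ← zpow_natCast, diagonal_eq_fin_two', ← hγ']
  exact ncard_selfDualStable_zpow_smul_one_eq_sum_at L v w hw hunr hu1 hN he1 _ hγ'

include hw in
/-- **KOTTWITZ'S VERTEX TOTAL AT `w`** (type (1)): `#S((Φ₂)_w, γ) + #M((Φ₂)_w, γ) = Σ_{j ≤ N} w(q_v, j)` — the `γ`-fixed self-dual and ϖ-modular vertices of the tree of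
`U(Φ₂)_v` together are ALL vertices of the fixed ball `B(centre, N)`, INDEPENDENTLY of the class bit (★ `exists_ncard_selfDualStable_antidiagTwo_eq_zpow_smul_one` gives the
self-dual half at parity `e`, `exists_ncard_modularStable_antidiagTwo_eq_sum_at` the ϖ-modular half at parity `1 − e`).  The Iwahori EDGE count is this total minus one;
`V₀ + V₁ − E = 1` is Kottwitz's `O_γ(f_EP) = χ(Fix γ)` for the rank-one Euler–Poincaré function. [cite: Kottwitz1988, §2] [cite: Rogawski1990, §12.6 p. 174] -/
theorem ncard_selfDualStable_add_ncard_modularStable_antidiagTwo_eq_sum_at (hunr : Algebra.IsUnramifiedIn (𝓞 L) v.asIdeal)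
    {γ P : GL (Fin 2) (w.1.adicCompletion L)} {u : Fin 2 → w.1.adicCompletion L}
    (hγ : γ ∈ Literature.AlgebraicGeometry.ShimuraVarieties.unitaryGroup (galAdicCompletionMap (L := L) (IsCMField.complexConj L) hw)
      (placeForm (Matrix.of fun i j : Fin 2 => if i.val + j.val + 1 = 2 then (1 : L) else 0) w.1))
    (hP : (γ : Matrix (Fin 2) (Fin 2) (w.1.adicCompletion L)) * P = P * diagonal u) (hu : Function.Injective u)
    (hu1 : ∀ i, galAdicCompletionMap (L := L) (IsCMField.complexConj L) hw (u i) * u i = 1) {N : ℕ}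
    (hN : valuation (w.1.adicCompletion L) (u 0 - u 1) =
      valuation (w.1.adicCompletion L) (toPlace v w (HeckeCharacter.uniformizer ↥(maximalRealSubfield L) v : v.adicCompletion ↥(maximalRealSubfield L)) ^ N)) :
    {Λ : Submodule 𝒪[w.1.adicCompletion L] (Fin 2 → w.1.adicCompletion L) |
          (∃ g : GL (Fin 2) (w.1.adicCompletion L),
            (∃ J' ∈ glInt 2 (w.1.adicCompletion L), (J' : Matrix (Fin 2) (Fin 2) (w.1.adicCompletion L)) =
              formCongr (galAdicCompletionMap (L := L) (IsCMField.complexConj L) hw) g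
                (placeForm (Matrix.of fun i j : Fin 2 => if i.val + j.val + 1 = 2 then (1 : L) else 0) w.1)) ∧
            Λ = Submodule.span 𝒪[w.1.adicCompletion L] (Set.range ((g : Matrix (Fin 2) (Fin 2) (w.1.adicCompletion L)))ᵀ)) ∧
          Λ.map ((Matrix.toLin' ((γ : GL (Fin 2) (w.1.adicCompletion L)) : Matrix (Fin 2) (Fin 2) (w.1.adicCompletion L))).restrictScalars
            𝒪[w.1.adicCompletion L]) = Λ}.ncard +
      {Λ : Submodule 𝒪[w.1.adicCompletion L] (Fin 2 → w.1.adicCompletion L) |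
          (∃ g : GL (Fin 2) (w.1.adicCompletion L),
            (∃ J' ∈ glInt 2 (w.1.adicCompletion L),
              (toPlace v w (HeckeCharacter.uniformizer ↥(maximalRealSubfield L) v : v.adicCompletion ↥(maximalRealSubfield L))) •
                  (J' : Matrix (Fin 2) (Fin 2) (w.1.adicCompletion L)) =
                formCongr (galAdicCompletionMap (L := L) (IsCMField.complexConj L) hw) g
                  (placeForm (Matrix.of fun i j : Fin 2 => if i.val + j.val + 1 = 2 then (1 : L) else 0) w.1)) ∧
            Λ = Submodule.span 𝒪[w.1.adicCompletion L] (Set.range ((g : Matrix (Fin 2) (Fin 2) (w.1.adicCompletion L)))ᵀ)) ∧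
          Λ.map ((Matrix.toLin' ((γ : GL (Fin 2) (w.1.adicCompletion L)) : Matrix (Fin 2) (Fin 2) (w.1.adicCompletion L))).restrictScalars
            𝒪[w.1.adicCompletion L]) = Λ}.ncard =
      ∑ j ∈ range (N + 1),
        (if j = 0 then 1 else Nat.card (𝓞 ↥(maximalRealSubfield L) ⧸ v.asIdeal) ^ (j - 1) * (Nat.card (𝓞 ↥(maximalRealSubfield L) ⧸ v.asIdeal) + 1)) := by
  -- the self-dual half at parity `e`
  obtain ⟨e, γ', he1, hpar, hγ', hS⟩ := exists_ncard_selfDualStable_antidiagTwo_eq_zpow_smul_one L v w hw hunr hγ hP hu hu1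
  rw [hS, ncard_selfDualStable_zpow_smul_one_eq_sum_at L v w hw hunr hu1 hN he1 γ' hγ']
  -- the ϖ-modular half at parity `e′` with `e′ = 1 − e`
  obtain ⟨e', he1', hpar', hM⟩ := exists_ncard_modularStable_antidiagTwo_eq_sum_at L v w hw hunr hγ hP hu hu1 hN
  rw [hM]
  have key : e' + e = 1 := by
    rcases Nat.le_one_iff_eq_zero_or_eq_one.1 he1 with rfl | rfl
    · have h := hpar'.1 (hpar.2 rfl); omega
    · have h2 : e' ≠ 1 := fun h => absurd (hpar.1 (hpar'.2 h)) (by omega)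
      omega
  have hee' : ∀ j : ℕ, j % 2 = e' ↔ ¬ j % 2 = e := fun j => by constructor <;> intro h <;> omega
  rw [← Finset.sum_filter_add_sum_filter_not (range (N + 1)) (fun j => j % 2 = e)]
  congr 1
  refine Finset.sum_congr ?_ fun _ _ => rfl
  ext j
  simp only [Finset.mem_filter, hee']

end CM

end UnitaryGroup

end Literature.NumberTheory.Automorphic

end
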